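import Literature.Barriers.QuantumAdvantage.AaronsonChenTableauFields
import Literature.Barriers.QuantumAdvantage.AaronsonChenTableau
import Literature.Computability.Complexity.PSpaceSignedSum
import Literature.Computability.Complexity.PSpaceClosure
import Literature.Computability.Complexity.LengthCompare
import HarnessLib

/-!
# The tableau threshold language of the `PSPACE^{TQBF}` simulator (Aaronson–Chen, Lemma 5.3) is in `PSPACE`

Sequel of `AaronsonChenTableauFields.lean` (formats, extractors, checks, weights) and
`AaronsonChenTableau.lean` (admissibility `tabAdm`, the counting identity `sum_tabAdm`). Here the
one-bit checks become LANGUAGES and the threshold language is assembled: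

* `testLang f = {v | f v = [1]}` is in `P` for `f ∈ FP` (normalising by `eqC [1]`);
* `LocL` (the local check), `GcondS`, `ASet` (guess condition, guess bit) `∈ P`; the guess language
  `GuessL B = {v | gcond v → (a v ↔ pay v ∈ B)}` `∈ PSPACE` for `B ∈ PSPACE`;
* `AdmL`, `AdmG B` (polynomially bounded universal quantification over the offsets,
  `polyForall_mem_PSPACE`), `InitS`, and **`Adm B ∈ PSPACE`**;
* **`acH B r`** `= {u | 0 < signedSum (Adm B) wpZ wnZ (r(|pad|)) u}` and **`acH_mem_PSPACE`**
  (`signedSum_pos_mem_PSPACE`, weights `≤ 1`);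
* the semantics of the checks on well-formed strings: `argV_mkV_eq_chkArg` (the record fed to
  `stepChkT` is the `chkArg` record of the item against the state before it), `locT_mkV` (the local
  check computes the spec `locVal`), `gcond_mkV` (guess condition = `guessAt`), `initT_mkZ`,
  `mkZ_mem_AdmL_iff`, `mkZ_mem_AdmG_iff`, `itemOK_iff` (itemOK = trusting step + guess condition)
  and **`mkZ_mem_Adm_iff`**: `⟨encInst …, Y⟩ ∈ Adm B` iff the tableau block of `Y` is admissible
  (`tabAdm B gts s₀ s₀ tab = true`) and the copied final states decode to the final states of the
  two walks (`tabFin`), via the index form `tabAdm_iff_forall` of admissibility.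

## References

* S. Aaronson, L. Chen, CCC 2017, §5.3 (pp. 22–23: "all the computations can be done in PSPACE")
  [AaronsonChen2017].
* S. Arora, B. Barak, *Computational Complexity: A Modern Approach*, CUP 2009, §4.2 (closure of
  PSPACE; TQBF), Thm. 4.13 [AroraBarakCC2009].
-/

noncomputable section

namespace Literature.Barriers.QuantumAdvantage

namespace AcTab

open _root_.Computability Polynomial Literature.Computability.Complexity Literature.Computability.Complexity.Brick
  Literature.Computability.Complexity.Plumb Literature.Computability.Cryptography Literature.Computability.QuantumComplexity
  Literature.Computability.QuantumComplexity.ADH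

attribute [-simp] Brick.nthF_zero Brick.sndPow_zero

variable {N : ℕ}

/-! ### Test languages -/

/-- The language of a string test: `{v | f v = [1]}`. [folklore] -/
def testLang (f : List Bool → List Bool) : Language Bool := {v | f v = [true]}

/-- Membership in a test language. [folklore] -/
@[simp] theorem mem_testLang {f : List Bool → List Bool} {v : List Bool} : v ∈ testLang f ↔ f v = [true] := Iff.rfl

/-- **A test language of an `FP` function is in `P`** (normalise the test by `eqC [1]`, which is
one-bit on every input). [cite: AroraBarakCC2009, §1.3] -/
theorem testLang_mem_P {f : List Bool → List Bool} (hf : f ∈ FP) : testLang f ∈ Classes.P := by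
  refine mem_P_of_mem_FP (eqC_mem_FP [true] hf) (testLang f) fun w => ⟨fun hw => ?_, fun hw => ?_⟩
  · rw [eqC_apply, decide_eq_true (show f w = [true] from hw)]
  · rw [eqC_apply, decide_eq_false (show ¬ f w = [true] from hw)]

/-- A test language of an `FP` function is in `PSPACE`. [cite: AroraBarakCC2009, §4.1 (P ⊆ PSPACE)] -/
theorem testLang_mem_PSPACE {f : List Bool → List Bool} (hf : f ∈ FP) : testLang f ∈ PSPACE :=
  P_subset_PSPACE_holds (testLang_mem_P hf)

/-! ### The languages of the checks -/

/-- The local-check language. [cite: AaronsonChen2017, §5.3 (pp. 22–23)] -/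
def LocL : Language Bool := testLang locT
/-- The guess-condition set. [folklore] -/
def GcondS : Language Bool := testLang gcondT
/-- The guess-bit set. [folklore] -/
def ASet : Language Bool := testLang aBitT
/-- **The guess language** relative to `B`: where the guess condition holds, the guess bit is
`B`'s answer on the payload. [cite: AaronsonChen2017, §5.3 (p. 22: "the known ones", answered by TQBF on the TQBF side)] -/
def GuessL (B : Language Bool) : Language Bool := {v | v ∈ GcondS → (v ∈ ASet ↔ payV v ∈ B)}
/-- The initial-state language. [folklore] -/
def InitS : Language Bool := testLang initT

/-- `LocL ∈ P`. [folklore] -/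
theorem LocL_mem_P : LocL ∈ Classes.P := testLang_mem_P locT_mem_FP
/-- `GcondS ∈ P`. [folklore] -/
theorem GcondS_mem_P : GcondS ∈ Classes.P := testLang_mem_P gcondT_mem_FP
/-- `ASet ∈ P`. [folklore] -/
theorem ASet_mem_P : ASet ∈ Classes.P := testLang_mem_P aBitT_mem_FP
/-- `InitS ∈ P`. [folklore] -/
theorem InitS_mem_P : InitS ∈ Classes.P := testLang_mem_P initT_mem_FP

/-- **`GuessL B ∈ PSPACE` for `B ∈ PSPACE`** (Boolean combination of `P` sets and the `FP`-preimage
`payV⁻¹ B`; unions through a `PSPACE`-complete `C`). [cite: AroraBarakCC2009, §4.2] -/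
theorem GuessL_mem_PSPACE {C B : Language Bool} (hC : IsComplete PSPACE C) (hB : B ∈ PSPACE) : GuessL B ∈ PSPACE := by
  have hpre : {v : List Bool | payV v ∈ B} ∈ PSPACE := preimage_mem_PSPACE hB payV_mem_FP
  have hA : {v : List Bool | v ∈ ASet} ∈ PSPACE := P_subset_PSPACE_holds ASet_mem_P
  have hG : {v : List Bool | v ∈ GcondS} ∈ PSPACE := P_subset_PSPACE_holds GcondS_mem_P
  have hiff : {v : List Bool | v ∈ ASet ↔ payV v ∈ B} ∈ PSPACE := by
    have h := setOf_and_mem_PSPACE_of_complete hC (setOf_imp_mem_PSPACE_of_complete hC hA hpre)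
      (setOf_imp_mem_PSPACE_of_complete hC hpre hA)
    have hset : {v : List Bool | v ∈ ASet ↔ payV v ∈ B} = {v | (v ∈ ASet → payV v ∈ B) ∧ (payV v ∈ B → v ∈ ASet)} :=
      Set.ext fun v => iff_def
    rw [hset]
    exact h
  exact setOf_imp_mem_PSPACE_of_complete hC hG hiff

/-! ### Admissibility and the threshold language -/

/-- The offset bound: offsets up to `q(|z|)` with `q = X² + 12X + 20` cover every item. [folklore] -/
def offQ : Polynomial ℕ := X ^ 2 + 12 * X + 20

/-- **Local admissibility**: every offset passes the local check. [cite: AaronsonChen2017, §5.3 (pp. 22–23)] -/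
def AdmL : Language Bool := {z | ∀ y : List Bool, y.length ≤ offQ.eval z.length → boolPair z y ∈ LocL}
/-- **Guess admissibility** relative to `B`. [cite: AaronsonChen2017, §5.3 (p. 22)] -/
def AdmG (B : Language Bool) : Language Bool := {z | ∀ y : List Bool, y.length ≤ offQ.eval z.length → boolPair z y ∈ GuessL B}
/-- **The admissible witnesses** `⟨u, Y⟩` relative to `B`. [cite: AaronsonChen2017, §5.3 (pp. 22–23)] -/
def Adm (B : Language Bool) : Language Bool := (AdmL ⊓ AdmG B) ⊓ InitS

/-- `AdmL ∈ PSPACE`. [cite: AroraBarakCC2009, §4.2] -/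
theorem AdmL_mem_PSPACE : AdmL ∈ PSPACE := polyForall_mem_PSPACE (P_subset_PSPACE_holds LocL_mem_P) offQ
/-- `AdmG B ∈ PSPACE`. [cite: AroraBarakCC2009, §4.2] -/
theorem AdmG_mem_PSPACE {C B : Language Bool} (hC : IsComplete PSPACE C) (hB : B ∈ PSPACE) : AdmG B ∈ PSPACE :=
  polyForall_mem_PSPACE (GuessL_mem_PSPACE hC hB) offQ
/-- **`Adm B ∈ PSPACE`.** [cite: AaronsonChen2017, §5.3 (p. 23: "all the computations can be done in PSPACE")] -/
theorem Adm_mem_PSPACE {C B : Language Bool} (hC : IsComplete PSPACE C) (hB : B ∈ PSPACE) : Adm B ∈ PSPACE :=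
  inter_mem_PSPACE_of_complete hC (inter_mem_PSPACE_of_complete hC AdmL_mem_PSPACE (AdmG_mem_PSPACE hC hB))
    (P_subset_PSPACE_holds InitS_mem_P)

/-- **The tableau threshold language** relative to `B`, witness length `r(|pad|)`:
`{u | 0 < Σ_{Y ∈ {0,1}^{r(|pad|)}} [⟨u,Y⟩ ∈ Adm B] (|wp| − |wn|)}`. [cite: AaronsonChen2017, §5.3 (p. 23)] -/
def acH (B : Language Bool) (r : Polynomial ℕ) : Language Bool :=
  {u | 0 < signedSum (Adm B) wpZ wnZ (r.eval (fstP u).length) u}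

/-- **The tableau threshold language is in `PSPACE`** (for `B ∈ PSPACE` and some `PSPACE`-complete `C`).
[cite: AaronsonChen2017, §5.3 (p. 23)] -/
theorem acH_mem_PSPACE {C B : Language Bool} (hC : IsComplete PSPACE C) (hB : B ∈ PSPACE) (r : Polynomial ℕ) :
    acH B r ∈ PSPACE :=
  signedSum_pos_mem_PSPACE hC (Adm_mem_PSPACE hC hB) wpZ_mem_FP wnZ_mem_FP 0 length_wpZ_le length_wnZ_le r

/-! ### Admissibility in index form -/

/-- The `ι`-th block of width `w` of a tableau. [folklore] -/
def blk (w : ℕ) (tab : List Bool) (ι : ℕ) : List Bool := (tab.drop (w * ι)).take w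

/-- Blocks of the tableau after the first two blocks. [folklore] -/
theorem blk_drop (w : ℕ) (tab : List Bool) (ι : ℕ) : blk w (tab.drop (2 * w)) ι = blk w tab (ι + 2) := by
  rw [blk, blk, List.drop_drop]
  congr 2
  ring

/-- Block `0` is the first item, block `1` the second. [folklore] -/
theorem blk_zero (w : ℕ) (tab : List Bool) : blk w tab 0 = tab.take w := by rw [blk, Nat.mul_zero, List.drop_zero]

/-- Block `1` is the second item. [folklore] -/
theorem blk_one (w : ℕ) (tab : List Bool) : blk w tab 1 = (tab.drop w).take w := by rw [blk, Nat.mul_one]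

/-- **The state of walk `π` before gate `i`**, read off the tableau: the initial state before gate
`0`, else the state claimed by the item of gate `i - 1` of that walk (block `2(i-1) + π`). [folklore] -/
def stAt (s : PState N) (tab : List Bool) (π : ℕ) : ℕ → PState N
  | 0 => s
  | i + 1 => (decItem (N := N) (blk (iw N) tab (2 * i + π))).st

/-- The states read off the shifted tableau. [folklore] -/
theorem stAt_drop (s : PState N) (tab : List Bool) (π : ℕ) (i : ℕ) :
    stAt (decItem (N := N) (blk (iw N) tab π)).st (tab.drop (2 * iw N)) π i = stAt s tab π (i + 1) := by
  cases i with
  | zero => simp [stAt]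
  | succ i =>
    simp only [stAt, blk_drop]
    congr 3
    ring

/-- **Admissibility in index form**: a tableau is admissible iff every item is `itemOK` against the
state read off the previous item of its walk, and then the final states are the states after the
last gate. [cite: AaronsonChen2017, §5.3 (pp. 22–23)] -/
theorem tabAdm_iff_forall (B : Language Bool) :
    ∀ (gts : List (QGate cliffordT N × List (List Bool))) (s₁ s₂ : PState N) (tab : List Bool),
    (tabAdm B gts s₁ s₂ tab = true ↔
      ∀ (i : ℕ) (h : i < gts.length),
        itemOK B (gts[i]).1 (gts[i]).2 (stAt s₁ tab 0 i) (decItem (N := N) (blk (iw N) tab (2 * i))) ∧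
        itemOK B (gts[i]).1 (gts[i]).2 (stAt s₂ tab 1 i) (decItem (N := N) (blk (iw N) tab (2 * i + 1)))) ∧
    tabFin gts s₁ s₂ tab = (stAt s₁ tab 0 gts.length, stAt s₂ tab 1 gts.length)
  | [], s₁, s₂, tab => by simp [tabAdm, tabFin, stAt]
  | (g, tbl) :: rest, s₁, s₂, tab => by
    obtain ⟨ih1, ih2⟩ := tabAdm_iff_forall B rest (decItem (N := N) (tab.take (iw N))).st
      (decItem (N := N) ((tab.drop (iw N)).take (iw N))).st (tab.drop (2 * iw N))
    have e0 : tab.take (iw N) = blk (iw N) tab 0 := (blk_zero _ _).symm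
    have e1 : (tab.drop (iw N)).take (iw N) = blk (iw N) tab 1 := (blk_one _ _).symm
    rw [e0, e1] at ih1 ih2
    simp only [stAt_drop s₁ tab 0, stAt_drop s₂ tab 1, blk_drop] at ih1 ih2
    constructor
    · rw [tabAdm, e0, e1, Bool.and_eq_true, Bool.and_eq_true, decide_eq_true_eq, decide_eq_true_eq, ih1]
      constructor
      · rintro ⟨⟨h0, h0'⟩, hr⟩ i hi
        cases i with
        | zero => exact ⟨h0, h0'⟩
        | succ i =>
          have hi' : i < rest.length := by simpa using hi
          have := hr i hi'
          simpa [stAt, Nat.mul_succ, List.getElem_cons_succ] using this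
      · intro h
        refine ⟨?_, fun i hi => ?_⟩
        · exact h 0 (by simp)
        · have := h (i + 1) (by simpa using Nat.succ_lt_succ hi)
          simpa [stAt, Nat.mul_succ, List.getElem_cons_succ] using this
    · rw [tabFin, e0, e1, ih2, List.length_cons]

/-! ### Values of the checks on well-formed strings -/

/-- Annotated gate codes are nonempty. [folklore] -/
theorem acGateCode_ne_nil (g : QGate cliffordT N) (tbl : List (List Bool)) : acGateCode g tbl ≠ [] := by
  cases g <;> simp [acGateCode, QGate.encode]

/-- The first symbol of an annotated gate code is the oracle tag. [folklore] -/
theorem take_one_acGateCode (g : QGate cliffordT N) (tbl : List (List Bool)) :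
    (acGateCode g tbl).take 1 = [match g with | .gate _ _ => false | .oracle _ _ => true] := by
  cases g with
  | gate op e => cases op <;> rfl
  | oracle k e => rfl

/-- Looking up a gate code. [folklore] -/
theorem codes_getD (gts : List (QGate cliffordT N × List (List Bool))) (i : ℕ) :
    (codes gts).getD i [] = if h : i < gts.length then acGateCode (gts[i]).1 (gts[i]).2 else [] := by
  unfold codes
  split_ifs with h
  · rw [List.getD_eq_getElem _ _ (by simpa using h), List.getElem_map]
  · rw [List.getD_eq_default _ _ (by simpa using h)]

/-- A gate code is empty iff the index is beyond the gates. [folklore] -/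
theorem codes_getD_eq_nil_iff (gts : List (QGate cliffordT N × List (List Bool))) (i : ℕ) :
    (codes gts).getD i [] = [] ↔ gts.length ≤ i := by
  rw [codes_getD]
  split_ifs with h
  · simp only [acGateCode_ne_nil, false_iff, not_le]; exact h
  · simp only [true_iff]; omega

/-- The length of a full block. [folklore] -/
theorem length_blk {w : ℕ} {tab : List Bool} {ι : ℕ} (h : w * (ι + 1) ≤ tab.length) : (blk w tab ι).length = w := by
  rw [blk, List.length_take, List.length_drop]
  have : w ≤ tab.length - w * ι := by rw [Nat.mul_succ] at h; omega
  omega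

/-- The two leading bits of an item of length `≥ 2`. [folklore] -/
theorem take_two_eq (v : List Bool) (hv : 2 ≤ v.length) : v.take 2 = [(decItem (N := N) v).c, (decItem (N := N) v).a] := by
  rcases v with _ | ⟨b₀, _ | ⟨b₁, v⟩⟩
  · simp at hv
  · simp at hv
  · rfl

/-- An item of length `N + 5` is `c :: a :: encLP st`. [folklore] -/
theorem drop_two_item (v : List Bool) (hv : v.length = N + 5) : v.drop 2 = encLP (decItem (N := N) v).st := by
  rw [Item.st, encLP, ofFn_decItem_lab v hv, bits3_decItem_ph v hv]
  conv_lhs => rw [← List.take_append_drop N (v.drop 2)]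
  rw [List.drop_drop, Nat.add_comm]

/-- **The spec of the local check** at offset `o` (Boolean): unaligned offsets and items beyond
the gates pass; the item `ι = o/(N+5)` of gate `i = ι/2`, walk `π = ι mod 2` must be the trusting
step of the state before it, and at the last gate claim the copied final state of its walk.
[cite: AaronsonChen2017, §5.3 (pp. 22–23)] -/
def locVal (gts : List (QGate cliffordT N × List (List Bool))) (w₀ : QReg N) (F₀ F₁ : List Bool) (tab : List Bool) (o : ℕ) : Bool :=
  if o % (N + 5) = 0 then
    match gts[o / (N + 5) / 2]? with
    | none => true
    | some gt =>
      decide (stepOut gt.1 gt.2 (decItem (N := N) (blk (N + 5) tab (o / (N + 5)))).c (decItem (N := N) (blk (N + 5) tab (o / (N + 5)))).a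
          (stAt ((w₀, 0) : PState N) tab (o / (N + 5) % 2) (o / (N + 5) / 2)).1
          (stAt ((w₀, 0) : PState N) tab (o / (N + 5) % 2) (o / (N + 5) / 2)).2 =
        some (decItem (N := N) (blk (N + 5) tab (o / (N + 5)))).st) &&
      (if o / (N + 5) / 2 + 1 < gts.length then true
       else decide ((blk (N + 5) tab (o / (N + 5))).drop 2 = if o / (N + 5) % 2 = 1 then F₁ else F₀))
  else true

/-- Phases of the states read off a tableau are residues modulo `8`. [folklore] -/
theorem stAt_ph_lt (w₀ : QReg N) (tab : List Bool) (π : ℕ) : ∀ i : ℕ, (stAt ((w₀, 0) : PState N) tab π i).2 < 8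
  | 0 => by simp [stAt]
  | i + 1 => decItem_ph_lt _

section LocValue

variable (pad : List Bool) (gts : List (QGate cliffordT N × List (List Bool))) (w₀ : QReg N) (P₁ P₂ : List (ℕ × Bool))
  (σ₁ : Bool) (n₁ : ℕ) (σ₂ : Bool) (n₂ : ℕ) (Y y : List Bool)

/-- **The argument record of an aligned item of a gate is the `chkArg` record** of the item
against the state before it. [cite: AaronsonChen2017, §5.3 (pp. 22–23)] -/
theorem argV_mkV_eq_chkArg (hY : hdr pad.length N + 2 * iw N * gts.length ≤ Y.length) {ι : ℕ} (hy : y.length = iw N * ι)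
    {i : ℕ} (hi : i < gts.length) (hι : ι / 2 = i) :
    argV (mkV pad gts w₀ P₁ P₂ σ₁ n₁ σ₂ n₂ Y y) =
      chkArg (acGateCode (gts[i]).1 (gts[i]).2)
        (decItem (N := N) (blk (iw N) (Y.drop (hdr pad.length N)) ι)).c
        (decItem (N := N) (blk (iw N) (Y.drop (hdr pad.length N)) ι)).a
        (List.ofFn (stAt ((w₀, 0) : PState N) (Y.drop (hdr pad.length N)) (ι % 2) i).1)
        (bits3 (stAt ((w₀, 0) : PState N) (Y.drop (hdr pad.length N)) (ι % 2) i).2)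
        (List.ofFn (decItem (N := N) (blk (iw N) (Y.drop (hdr pad.length N)) ι)).lab)
        (bits3 (decItem (N := N) (blk (iw N) (Y.drop (hdr pad.length N)) ι)).ph) := by
  set tab := Y.drop (hdr pad.length N) with htabdef
  have hw : iw N = N + 5 := rfl
  have hιi : y.length / (N + 5) = ι := by rw [hy, hw, Nat.mul_div_cancel_left _ (by omega)]
  have htab : (iw N) * (ι + 1) ≤ tab.length := by
    have : ι < 2 * gts.length := by omega
    rw [htabdef, List.length_drop]
    have h2 : iw N * (ι + 1) ≤ iw N * (2 * gts.length) := Nat.mul_le_mul_left _ (by omega)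
    rw [show iw N * (2 * gts.length) = 2 * iw N * gts.length by ring] at h2
    omega
  have hlen : (blk (iw N) tab ι).length = N + 5 := length_blk htab
  have hitem : itemV (mkV pad gts w₀ P₁ P₂ σ₁ n₁ σ₂ n₂ Y y) = blk (iw N) tab ι := by
    rw [itemV_mkV, hy]; rfl
  have hcode : codeV (mkV pad gts w₀ P₁ P₂ σ₁ n₁ σ₂ n₂ Y y) = acGateCode (gts[i]).1 (gts[i]).2 := by
    rw [codeV_mkV, hιi, hι, codes_getD, dif_pos hi]
  -- the state before the item
  have hprevL : prevLabV (mkV pad gts w₀ P₁ P₂ σ₁ n₁ σ₂ n₂ Y y) = List.ofFn (stAt ((w₀, 0) : PState N) tab (ι % 2) i).1 ∧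
      prevPhV (mkV pad gts w₀ P₁ P₂ σ₁ n₁ σ₂ n₂ Y y) = bits3 (stAt ((w₀, 0) : PState N) tab (ι % 2) i).2 := by
    rw [prevLabV_mkV, prevPhV_mkV, hιi, hι]
    cases i with
    | zero =>
      rw [if_pos rfl, if_pos rfl]
      exact ⟨rfl, by simp [stAt, bits3]⟩
    | succ i =>
      have hι2 : 2 ≤ ι := by omega
      have hprev : prevV (mkV pad gts w₀ P₁ P₂ σ₁ n₁ σ₂ n₂ Y y) = blk (iw N) tab (ι - 2) := by
        rw [prevV_mkV, hy, hw, show (N + 5) * ι - 2 * (N + 5) = (N + 5) * (ι - 2) by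
          rw [Nat.mul_sub_left_distrib, Nat.mul_comm 2 (N + 5)]]
        rfl
      have hlen' : (blk (iw N) tab (ι - 2)).length = N + 5 :=
        length_blk ((Nat.mul_le_mul_left _ (by omega)).trans htab)
      have hs : stAt ((w₀, 0) : PState N) tab (ι % 2) (i + 1) = (decItem (N := N) (blk (iw N) tab (ι - 2))).st := by
        have e : 2 * i + ι % 2 = ι - 2 := by omega
        simp only [stAt, e]
      rw [if_neg (Nat.succ_ne_zero i), if_neg (Nat.succ_ne_zero i), hprev, hs, Item.st, ofFn_decItem_lab _ hlen',
        bits3_decItem_ph _ hlen']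
      exact ⟨rfl, rfl⟩
  have h2 : caOf itemV (mkV pad gts w₀ P₁ P₂ σ₁ n₁ σ₂ n₂ Y y) =
      [(decItem (N := N) (blk (iw N) tab ι)).c, (decItem (N := N) (blk (iw N) tab ι)).a] := by
    rw [caOf_mkV, hitem, take_two_eq _ (by rw [hlen]; omega)]
  have h3 : labOf itemV (mkV pad gts w₀ P₁ P₂ σ₁ n₁ σ₂ n₂ Y y) = List.ofFn (decItem (N := N) (blk (iw N) tab ι)).lab := by
    rw [labOf_mkV, hitem, ofFn_decItem_lab _ hlen]
  have h4 : phOf itemV (mkV pad gts w₀ P₁ P₂ σ₁ n₁ σ₂ n₂ Y y) = bits3 (decItem (N := N) (blk (iw N) tab ι)).ph := by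
    rw [phOf_mkV, hitem, bits3_decItem_ph _ hlen]
  rw [argV, fanoutFn_apply, fanoutFn_apply, fanoutFn_apply, fanoutFn_apply, fanoutFn_apply, hcode, h2, hprevL.1, hprevL.2,
    h3, h4, chkArg]

/-- **Value of the local check** on a well-formed element: the spec `locVal`. [cite: AaronsonChen2017, §5.3 (pp. 22–23)] -/
theorem locT_mkV (hY : hdr pad.length N + 2 * iw N * gts.length ≤ Y.length) :
    locT (mkV pad gts w₀ P₁ P₂ σ₁ n₁ σ₂ n₂ Y y) =
      [locVal gts w₀ (finOf pad.length N Y false) (finOf pad.length N Y true) (Y.drop (hdr pad.length N)) y.length] := by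
  have hw : iw N = N + 5 := rfl
  rw [locT, iteFn_apply (alignedT_mkV pad gts w₀ P₁ P₂ σ₁ n₁ σ₂ n₂ Y y), locVal]
  by_cases hal : y.length % (N + 5) = 0
  · rw [decide_eq_true hal, if_pos rfl, if_pos hal]
    set ι := y.length / (N + 5) with hιdef
    set tab := Y.drop (hdr pad.length N) with htabdef
    have hiso : (isNilFn ∘ codeV) (mkV pad gts w₀ P₁ P₂ σ₁ n₁ σ₂ n₂ Y y) = [decide (gts.length ≤ ι / 2)] := by
      rw [Function.comp_apply, codeV_mkV, isNilFn]
      simp only [codes_getD_eq_nil_iff, ← hιdef]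
    rw [iteFn_apply hiso]
    by_cases hG : gts.length ≤ ι / 2
    · rw [decide_eq_true hG, if_pos rfl, List.getElem?_eq_none (by omega)]
    · have hi : ι / 2 < gts.length := by omega
      rw [decide_eq_false hG, if_neg Bool.false_ne_true, List.getElem?_eq_getElem hi]
      simp only
      have hy' : y.length = iw N * ι := by rw [hw, hιdef]; exact (Nat.mul_div_cancel' (Nat.dvd_of_mod_eq_zero hal)).symm
      have htabl : (N + 5) * (ι + 1) ≤ tab.length := by
        have : ι < 2 * gts.length := by omega
        rw [htabdef, List.length_drop]
        have h2 : iw N * (ι + 1) ≤ iw N * (2 * gts.length) := Nat.mul_le_mul_left _ (by omega)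
        rw [show iw N * (2 * gts.length) = 2 * iw N * gts.length by ring] at h2
        rw [← hw]; omega
      have hlen : (blk (N + 5) tab ι).length = N + 5 := length_blk htabl
      -- the one-gate check
      have hchk : (stepChkT ∘ argV) (mkV pad gts w₀ P₁ P₂ σ₁ n₁ σ₂ n₂ Y y) =
          [decide (stepOut (gts[ι / 2]).1 (gts[ι / 2]).2 (decItem (N := N) (blk (N + 5) tab ι)).c
            (decItem (N := N) (blk (N + 5) tab ι)).a (stAt ((w₀, 0) : PState N) tab (ι % 2) (ι / 2)).1
            (stAt ((w₀, 0) : PState N) tab (ι % 2) (ι / 2)).2 =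
            some (decItem (N := N) (blk (N + 5) tab ι)).st)] := by
        rw [Function.comp_apply, argV_mkV_eq_chkArg pad gts w₀ P₁ P₂ σ₁ n₁ σ₂ n₂ Y y hY hy' hi rfl,
          stepChkT_chkArg _ _ _ _ _ _ (stAt_ph_lt w₀ _ _ _) (decItem_ph_lt _)]
        rfl
      -- the last-gate condition
      have hnext : (isNilFn ∘ codeNextV) (mkV pad gts w₀ P₁ P₂ σ₁ n₁ σ₂ n₂ Y y) = [decide (gts.length ≤ ι / 2 + 1)] := by
        rw [Function.comp_apply, codeNextV_mkV, isNilFn]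
        simp only [codes_getD_eq_nil_iff, ← hιdef]
      have hitem : itemV (mkV pad gts w₀ P₁ P₂ σ₁ n₁ σ₂ n₂ Y y) = blk (N + 5) tab ι := by
        rw [itemV_mkV, hy']; rfl
      have hfin : finEqT (mkV pad gts w₀ P₁ P₂ σ₁ n₁ σ₂ n₂ Y y) =
          [decide ((blk (N + 5) tab ι).drop 2 = if ι % 2 = 1 then finOf pad.length N Y true else finOf pad.length N Y false)] := by
        rw [finEqT, Function.comp_apply, fanoutFn_apply, Function.comp_apply, fanoutFn_apply, hitem, dropFn_boolPair, length_ones,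
          finOfParV, iteFn_apply (parT_mkV pad gts w₀ P₁ P₂ σ₁ n₁ σ₂ n₂ Y y), eqPairFn_boolPair]
        simp only [Function.comp_apply, zV_mkV]
        rw [show f2Z (boolPair (encInst pad gts w₀ P₁ P₂ σ₁ n₁ σ₂ n₂) Y) = finOf pad.length N Y true from f2Z_mkZ pad gts w₀ P₁ P₂ σ₁ n₁ σ₂ n₂ Y,
          show f1Z (boolPair (encInst pad gts w₀ P₁ P₂ σ₁ n₁ σ₂ n₂) Y) = finOf pad.length N Y false from f1Z_mkZ pad gts w₀ P₁ P₂ σ₁ n₁ σ₂ n₂ Y]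
        by_cases hπ : ι % 2 = 1
        · rw [decide_eq_true hπ, if_pos rfl, if_pos hπ]
        · rw [decide_eq_false hπ, if_neg Bool.false_ne_true, if_neg hπ]
      have hlast : (iteFn (isNilFn ∘ codeNextV) finEqT (fun _ => [true])) (mkV pad gts w₀ P₁ P₂ σ₁ n₁ σ₂ n₂ Y y) =
          [if ι / 2 + 1 < gts.length then true
           else decide ((blk (N + 5) tab ι).drop 2 = if ι % 2 = 1 then finOf pad.length N Y true else finOf pad.length N Y false)] := by
        rw [iteFn_apply hnext]
        by_cases hl : ι / 2 + 1 < gts.length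
        · rw [if_pos hl, decide_eq_false (by omega : ¬ gts.length ≤ ι / 2 + 1), if_neg Bool.false_ne_true]
        · rw [if_neg hl, decide_eq_true (by omega : gts.length ≤ ι / 2 + 1), if_pos rfl, hfin]
      rw [andFn_apply hchk hlast]
  · rw [decide_eq_false hal, if_neg Bool.false_ne_true, if_neg hal]

/-- A false left conjunct decides `andFn` whatever the right one. [folklore] -/
theorem andFn_apply_false_left {c d : List Bool → List Bool} {z : List Bool} (h : c z = [false]) : andFn c d z = [false] := by
  rw [andFn, iteFn_apply_false h]

/-- **The guess datum at offset `o`**: an aligned item of an ORACLE gate whose query on the state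
before it is a `0`-side query `0p` carries the pair (payload `p`, guess bit); nothing otherwise.
[cite: AaronsonChen2017, §5.3 (p. 22)] -/
def guessAt (gts : List (QGate cliffordT N × List (List Bool))) (w₀ : QReg N) (tab : List Bool) (o : ℕ) : Option (List Bool × Bool) :=
  if o % (N + 5) = 0 then
    match gts[o / (N + 5) / 2]? with
    | some (QGate.oracle _ e, _) =>
      match queryOf e (stAt ((w₀, 0) : PState N) tab (o / (N + 5) % 2) (o / (N + 5) / 2)).1 with
      | false :: p => some (p, (decItem (N := N) (blk (N + 5) tab (o / (N + 5)))).a)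
      | _ => none
    | _ => none
  else none

/-- The side test, the payload and the guess bit on the record of an oracle gate. [folklore] -/
theorem oracle_side_fields {k : ℕ} (e : Fin (k + 1) ↪ Fin N) (tbl : List (List Bool)) (c a : Bool) (w w' : QReg N)
    (ph ph' : List Bool) :
    let z := chkArg (acGateCode (QGate.oracle k e) tbl) c a (List.ofFn w) ph (List.ofFn w') ph'
    sideT z = [oside (queryOf e w)] ∧ payF z = (queryOf e w).tail ∧ aT z = [a] ∧
      (eqC [true] (take1Fn ∘ gcF)) z = [true] := by
  intro z
  obtain ⟨-, -, -, hq, -⟩ := oracle_fields e tbl c a w w' ph ph'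
  have hnil : nilT z = [decide (queryOf e w = [])] := by rw [nilT, Function.comp_apply, hq, isNilFn]
  refine ⟨?_, by rw [payF, Function.comp_apply, hq], aT_chkArg _ _ _ _ _ _ _, ?_⟩
  · rw [sideT, iteFn_apply hnil]
    rcases hqe : queryOf e w with _ | ⟨b, q⟩
    · simp [oside]
    · rw [decide_eq_false (by simp), if_neg Bool.false_ne_true, Function.comp_apply, hq, hqe]
      rfl
  · rw [eqC_apply, Function.comp_apply, gcF_chkArg]
    rfl

/-- **Value of the guess condition** on a well-formed element, and the payload and guess bit where
it holds. [cite: AaronsonChen2017, §5.3 (p. 22)] -/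
theorem gcond_mkV (hY : hdr pad.length N + 2 * iw N * gts.length ≤ Y.length) :
    gcondT (mkV pad gts w₀ P₁ P₂ σ₁ n₁ σ₂ n₂ Y y) = [(guessAt gts w₀ (Y.drop (hdr pad.length N)) y.length).isSome] ∧
    ∀ p : List Bool, ∀ b : Bool, guessAt gts w₀ (Y.drop (hdr pad.length N)) y.length = some (p, b) →
      payV (mkV pad gts w₀ P₁ P₂ σ₁ n₁ σ₂ n₂ Y y) = p ∧ aBitT (mkV pad gts w₀ P₁ P₂ σ₁ n₁ σ₂ n₂ Y y) = [b] := by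
  have hw : iw N = N + 5 := rfl
  rw [gcondT, guessAt]
  by_cases hal : y.length % (N + 5) = 0
  · rw [if_pos hal]
    set ι := y.length / (N + 5) with hιdef
    set tab := Y.drop (hdr pad.length N) with htabdef
    have hal' : alignedT (mkV pad gts w₀ P₁ P₂ σ₁ n₁ σ₂ n₂ Y y) = [true] := by
      rw [alignedT_mkV, decide_eq_true hal]
    have hiso : (notFn (isNilFn ∘ codeV)) (mkV pad gts w₀ P₁ P₂ σ₁ n₁ σ₂ n₂ Y y) = [decide (ι / 2 < gts.length)] := by
      rw [notFn_apply (show (isNilFn ∘ codeV) (mkV pad gts w₀ P₁ P₂ σ₁ n₁ σ₂ n₂ Y y) = [decide (gts.length ≤ ι / 2)] by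
        rw [Function.comp_apply, codeV_mkV, isNilFn]; simp only [codes_getD_eq_nil_iff, ← hιdef])]
      simp only [← decide_not, not_le]
    rw [andFn, iteFn_apply_true hal']
    by_cases hi : ι / 2 < gts.length
    · rw [andFn, iteFn_apply_true (by rw [hiso, decide_eq_true hi]), List.getElem?_eq_getElem hi]
      have hy' : y.length = iw N * ι := by rw [hw, hιdef]; exact (Nat.mul_div_cancel' (Nat.dvd_of_mod_eq_zero hal)).symm
      have harg := argV_mkV_eq_chkArg pad gts w₀ P₁ P₂ σ₁ n₁ σ₂ n₂ Y y hY hy' hi rfl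
      rcases hg : gts[ι / 2] with ⟨⟨op, e⟩ | ⟨k, e⟩, tbl⟩
      · -- a gate symbol: the tag is `0`
        have htag : (eqC [true] (take1Fn ∘ codeV)) (mkV pad gts w₀ P₁ P₂ σ₁ n₁ σ₂ n₂ Y y) = [false] := by
          rw [eqC_apply, Function.comp_apply, codeV_mkV, ← hιdef, codes_getD, dif_pos hi, hg]
          cases op <;> rfl
        refine ⟨by rw [andFn_apply_false_left htag]; rfl, fun p b h => ?_⟩
        simp at h
      · -- an oracle gate
        rw [hg] at harg
        dsimp only
        obtain ⟨hside, hpay, haT, -⟩ := oracle_side_fields e tbl (decItem (N := N) (blk (iw N) tab ι)).c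
          (decItem (N := N) (blk (iw N) tab ι)).a (stAt ((w₀, 0) : PState N) tab (ι % 2) (ι / 2)).1
          (decItem (N := N) (blk (iw N) tab ι)).lab (bits3 (stAt ((w₀, 0) : PState N) tab (ι % 2) (ι / 2)).2)
          (bits3 (decItem (N := N) (blk (iw N) tab ι)).ph)
        have hside' : (sideT ∘ argV) (mkV pad gts w₀ P₁ P₂ σ₁ n₁ σ₂ n₂ Y y) =
            [oside (queryOf e (stAt ((w₀, 0) : PState N) tab (ι % 2) (ι / 2)).1)] := by
          rw [Function.comp_apply, harg]; exact hside
        have hpay' : payV (mkV pad gts w₀ P₁ P₂ σ₁ n₁ σ₂ n₂ Y y) = (queryOf e (stAt ((w₀, 0) : PState N) tab (ι % 2) (ι / 2)).1).tail := by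
          rw [payV, Function.comp_apply, harg]; exact hpay
        have haT' : aBitT (mkV pad gts w₀ P₁ P₂ σ₁ n₁ σ₂ n₂ Y y) = [(decItem (N := N) (blk (iw N) tab ι)).a] := by
          rw [aBitT, Function.comp_apply, harg]; exact haT
        have htag : (eqC [true] (take1Fn ∘ codeV)) (mkV pad gts w₀ P₁ P₂ σ₁ n₁ σ₂ n₂ Y y) = [true] := by
          rw [eqC_apply, Function.comp_apply, codeV_mkV, ← hιdef, codes_getD, dif_pos hi, hg]; rfl
        rw [andFn_apply htag (notFn_apply hside')]
        rcases hq : queryOf e (stAt ((w₀, 0) : PState N) tab (ι % 2) (ι / 2)).1 with _ | ⟨_ | _, q⟩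
        · exact ⟨rfl, fun p b h => by simp at h⟩
        · refine ⟨rfl, fun p b h => ?_⟩
          simp only [Option.some.injEq, Prod.mk.injEq] at h
          obtain ⟨rfl, rfl⟩ := h
          rw [hq] at hpay'
          exact ⟨hpay', haT'⟩
        · exact ⟨rfl, fun p b h => by simp at h⟩
    · rw [andFn_apply_false_left (by rw [hiso, decide_eq_false hi]), List.getElem?_eq_none (by omega)]
      exact ⟨rfl, fun p b h => by simp at h⟩
  · rw [if_neg hal, andFn_apply_false_left (by rw [alignedT_mkV, decide_eq_false hal])]
    exact ⟨rfl, fun p b h => by simp at h⟩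

/-- **Value of the initial-state check**: if there is no gate, both copied final states are
`ofFn w₀ ++ 000`. [folklore] -/
theorem initT_mkZ :
    initT (mkZ pad gts w₀ P₁ P₂ σ₁ n₁ σ₂ n₂ Y) =
      [decide (gts = [] → finOf pad.length N Y false = List.ofFn w₀ ++ [false, false, false] ∧
        finOf pad.length N Y true = List.ofFn w₀ ++ [false, false, false])] := by
  obtain ⟨-, hgas, hw0, -⟩ := fields_encInst pad gts w₀ P₁ P₂ σ₁ n₁ σ₂ n₂ Y
  have hnil : (isNilFn ∘ fstF ∘ gasZ) (mkZ pad gts w₀ P₁ P₂ σ₁ n₁ σ₂ n₂ Y) = [decide (gts = [])] := by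
    rw [Function.comp_apply, Function.comp_apply, mkZ, hgas, gasCode, fstF_encList, isNilFn]
    cases gts with
    | nil => rfl
    | cons gt rest => simp [acGateCode_ne_nil]
  have h1 : (eqPairFn ∘ fanoutFn f1Z (OracleCompose.concatFn ∘ fanoutFn w0Z (fun _ => [false, false, false])))
      (mkZ pad gts w₀ P₁ P₂ σ₁ n₁ σ₂ n₂ Y) = [decide (finOf pad.length N Y false = List.ofFn w₀ ++ [false, false, false])] := by
    rw [Function.comp_apply, fanoutFn_apply, f1Z_mkZ, Function.comp_apply, fanoutFn_apply, mkZ, hw0, OracleCompose.concatFn_boolPair,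
      eqPairFn_boolPair]
  have h2 : (eqPairFn ∘ fanoutFn f2Z (OracleCompose.concatFn ∘ fanoutFn w0Z (fun _ => [false, false, false])))
      (mkZ pad gts w₀ P₁ P₂ σ₁ n₁ σ₂ n₂ Y) = [decide (finOf pad.length N Y true = List.ofFn w₀ ++ [false, false, false])] := by
    rw [Function.comp_apply, fanoutFn_apply, f2Z_mkZ, Function.comp_apply, fanoutFn_apply, mkZ, hw0, OracleCompose.concatFn_boolPair,
      eqPairFn_boolPair]
  rw [initT, iteFn_apply hnil]
  by_cases hg : gts = []
  · rw [decide_eq_true hg, if_pos rfl, andFn_apply h1 h2]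
    simp only [hg, true_implies, Bool.decide_and]
  · rw [decide_eq_false hg, if_neg Bool.false_ne_true]
    simp only [hg, false_implies, decide_true]

end LocValue

/-! ### Membership in the admissibility language -/

section Membership

variable (B : Language Bool) (pad : List Bool) (gts : List (QGate cliffordT N × List (List Bool))) (w₀ : QReg N)
  (P₁ P₂ : List (ℕ × Bool)) (σ₁ : Bool) (n₁ : ℕ) (σ₂ : Bool) (n₂ : ℕ) (Y : List Bool)

/-- The offset bound covers every item: `(N+5)·ι ≤ q(|z|)` for `ι < 2|gts|` when `N, |gts| ≤ |pad|`. [folklore] -/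
theorem offset_le_offQ (hN : N ≤ pad.length) (hG : gts.length ≤ pad.length) {ι : ℕ} (hι : ι < 2 * gts.length) :
    (N + 5) * ι ≤ offQ.eval (mkZ pad gts w₀ P₁ P₂ σ₁ n₁ σ₂ n₂ Y).length := by
  have hz : 4 * pad.length ≤ (mkZ pad gts w₀ P₁ P₂ σ₁ n₁ σ₂ n₂ Y).length := by
    rw [mkZ, length_boolPair, encInst, length_boolPair]; omega
  simp only [offQ, eval_add, eval_pow, eval_X, eval_mul, eval_ofNat]
  have h1 : (N + 5) * ι ≤ (pad.length + 5) * (2 * pad.length) := Nat.mul_le_mul (by omega) (by omega)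
  have h2 : (pad.length + 5) * (2 * pad.length) ≤ (mkZ pad gts w₀ P₁ P₂ σ₁ n₁ σ₂ n₂ Y).length ^ 2 +
      12 * (mkZ pad gts w₀ P₁ P₂ σ₁ n₁ σ₂ n₂ Y).length + 20 := by
    set m := (mkZ pad gts w₀ P₁ P₂ σ₁ n₁ σ₂ n₂ Y).length
    nlinarith
  omega

/-- **Membership in `AdmL`**: on a well-formed `z`, every item passes the local spec. [cite: AaronsonChen2017, §5.3 (pp. 22–23)] -/
theorem mkZ_mem_AdmL_iff (hN : N ≤ pad.length) (hG : gts.length ≤ pad.length)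
    (hY : hdr pad.length N + 2 * iw N * gts.length ≤ Y.length) :
    mkZ pad gts w₀ P₁ P₂ σ₁ n₁ σ₂ n₂ Y ∈ AdmL ↔
      ∀ ι < 2 * gts.length, locVal gts w₀ (finOf pad.length N Y false) (finOf pad.length N Y true) (Y.drop (hdr pad.length N))
        ((N + 5) * ι) = true := by
  constructor
  · intro h ι hι
    have hy := h (List.replicate ((N + 5) * ι) true) (by rw [List.length_replicate]; exact offset_le_offQ pad gts w₀ P₁ P₂ σ₁ n₁ σ₂ n₂ Y hN hG hι)
    rw [LocL, mem_testLang, show boolPair (mkZ pad gts w₀ P₁ P₂ σ₁ n₁ σ₂ n₂ Y) (List.replicate ((N + 5) * ι) true) =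
      mkV pad gts w₀ P₁ P₂ σ₁ n₁ σ₂ n₂ Y (List.replicate ((N + 5) * ι) true) from rfl, locT_mkV _ _ _ _ _ _ _ _ _ _ _ hY,
      List.length_replicate] at hy
    simpa using hy
  · intro h y _
    rw [LocL, mem_testLang, show boolPair (mkZ pad gts w₀ P₁ P₂ σ₁ n₁ σ₂ n₂ Y) y = mkV pad gts w₀ P₁ P₂ σ₁ n₁ σ₂ n₂ Y y from rfl,
      locT_mkV _ _ _ _ _ _ _ _ _ _ _ hY]
    by_cases hal : y.length % (N + 5) = 0
    · obtain ⟨ι, hι⟩ : (N + 5) ∣ y.length := Nat.dvd_of_mod_eq_zero hal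
      by_cases hlt : ι < 2 * gts.length
      · rw [hι, h ι hlt]
      · -- beyond the gates: the code lookup is empty
        rw [locVal, if_pos hal, hι, Nat.mul_div_cancel_left _ (by omega : 0 < N + 5),
          List.getElem?_eq_none (by omega)]
    · rw [locVal, if_neg hal]

/-- **Membership in `AdmG B`**: on a well-formed `z`, every guess datum is answered by `B`. [cite: AaronsonChen2017, §5.3 (p. 22)] -/
theorem mkZ_mem_AdmG_iff (hN : N ≤ pad.length) (hG : gts.length ≤ pad.length)
    (hY : hdr pad.length N + 2 * iw N * gts.length ≤ Y.length) :
    mkZ pad gts w₀ P₁ P₂ σ₁ n₁ σ₂ n₂ Y ∈ AdmG B ↔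
      ∀ ι < 2 * gts.length, ∀ p : List Bool, ∀ b : Bool,
        guessAt gts w₀ (Y.drop (hdr pad.length N)) ((N + 5) * ι) = some (p, b) → (b = true ↔ p ∈ B) := by
  have key : ∀ y : List Bool, boolPair (mkZ pad gts w₀ P₁ P₂ σ₁ n₁ σ₂ n₂ Y) y ∈ GuessL B ↔
      ∀ p : List Bool, ∀ b : Bool, guessAt gts w₀ (Y.drop (hdr pad.length N)) y.length = some (p, b) → (b = true ↔ p ∈ B) := by
    intro y
    obtain ⟨hc, hpb⟩ := gcond_mkV pad gts w₀ P₁ P₂ σ₁ n₁ σ₂ n₂ Y y hY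
    change (mkV pad gts w₀ P₁ P₂ σ₁ n₁ σ₂ n₂ Y y ∈ GcondS → (mkV pad gts w₀ P₁ P₂ σ₁ n₁ σ₂ n₂ Y y ∈ ASet ↔
      payV (mkV pad gts w₀ P₁ P₂ σ₁ n₁ σ₂ n₂ Y y) ∈ B)) ↔ _
    rw [GcondS, mem_testLang, hc, ASet, mem_testLang]
    rcases hga : guessAt gts w₀ (Y.drop (hdr pad.length N)) y.length with _ | ⟨p, b⟩
    · simp
    · obtain ⟨hp, hb⟩ := hpb p b hga
      simp only [Option.isSome_some, true_implies, hb, hp, List.cons.injEq, and_true, Option.some.injEq, Prod.mk.injEq]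
      constructor
      · rintro h p' b' ⟨rfl, rfl⟩; exact h
      · intro h; exact h p b ⟨rfl, rfl⟩
  constructor
  · intro h ι hι
    have hy := h (List.replicate ((N + 5) * ι) true) (by rw [List.length_replicate]; exact offset_le_offQ pad gts w₀ P₁ P₂ σ₁ n₁ σ₂ n₂ Y hN hG hι)
    rw [key, List.length_replicate] at hy
    exact hy
  · intro h y _
    rw [key]
    intro p b hpb
    have hal : y.length % (N + 5) = 0 := by
      by_contra hne; rw [guessAt, if_neg hne] at hpb; exact absurd hpb (by simp)
    obtain ⟨ι, hι⟩ : (N + 5) ∣ y.length := Nat.dvd_of_mod_eq_zero hal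
    by_cases hlt : ι < 2 * gts.length
    · exact h ι hlt p b (by rw [← hι]; exact hpb)
    · exfalso
      rw [guessAt, if_pos hal, hι, Nat.mul_div_cancel_left _ (by omega : 0 < N + 5), List.getElem?_eq_none (by omega)] at hpb
      exact absurd hpb (by simp)

/-- Quantifying over `ι < 2G` is quantifying over the gate `i < G` and the walk. [folklore] -/
theorem forall_lt_two_mul {P : ℕ → Prop} {G : ℕ} : (∀ ι < 2 * G, P ι) ↔ ∀ i < G, P (2 * i) ∧ P (2 * i + 1) := by
  constructor
  · intro h i hi; exact ⟨h _ (by omega), h _ (by omega)⟩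
  · intro h ι hι
    obtain ⟨i, rfl | rfl⟩ : ∃ i, ι = 2 * i ∨ ι = 2 * i + 1 := ⟨ι / 2, by omega⟩
    · exact (h i (by omega)).1
    · exact (h i (by omega)).2

/-- The guess datum of an item against a state: for an oracle gate with a `0`-side query `0p`,
the pair (`p`, guess bit). [folklore] -/
def gdat (g : QGate cliffordT N) (s : PState N) (it : Item N) : Option (List Bool × Bool) :=
  match g with
  | QGate.oracle _ e =>
    match queryOf e s.1 with
    | false :: p => some (p, it.a)
    | _ => none
  | QGate.gate _ _ => none

/-- The indicator of a language as a Boolean equation. [folklore] -/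
theorem eq_boolIndicator_iff (L : Language Bool) (w : List Bool) (b : Bool) : b = L.boolIndicator w ↔ (b = true ↔ w ∈ L) := by
  by_cases hw : w ∈ L
  · rw [(Set.mem_iff_boolIndicator _ _).1 hw]; simp [hw]
  · rw [(Set.notMem_iff_boolIndicator _ _).1 hw]; simp [hw]

/-- **`itemOK` is the trusting step plus the guess condition**: given that the item is the
trusting step of the state, its guess bit is the correct one iff, at a `0`-side oracle query `0p`,
it is `[p ∈ B]` (elsewhere the trusting step already forces the bit `0`). [cite: AaronsonChen2017, §5.3 (p. 22)] -/
theorem itemOK_iff (B : Language Bool) (g : QGate cliffordT N) (tbl : List (List Bool)) (s : PState N) (it : Item N) :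
    itemOK B g tbl s it ↔ stepOut g tbl it.c it.a s.1 s.2 = some it.st ∧
      ∀ (p : List Bool) (b : Bool), gdat g s it = some (p, b) → (b = true ↔ p ∈ B) := by
  unfold itemOK Item.st
  refine and_congr_right fun hstep => ?_
  cases g with
  | gate op e =>
    -- a gate symbol: the step forces `a = 0`, and there is no guess datum
    have ha : it.a = false := by
      simp only [stepOut, trustStep] at hstep
      cases h : it.a
      · rfl
      · rw [h] at hstep; simp at hstep
    simp [guessOf, gdat, ha]
  | oracle k e =>
    simp only [stepOut, trustStep] at hstep
    simp only [guessOf, gdat]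
    rcases hq : queryOf e s.1 with _ | ⟨_ | _, p⟩
    · -- empty query: `a = 0`
      rw [hq] at hstep
      have ha : it.a = false := by
        cases h : it.a
        · rfl
        · rw [h] at hstep; simp [oStep] at hstep
      simp [oGuess, ha]
    · -- `0`-side query `0p`: the guess must be `[p ∈ B]`
      simp only [oGuess, Option.some.injEq, Prod.mk.injEq]
      rw [eq_boolIndicator_iff]
      constructor
      · rintro h p' b ⟨rfl, rfl⟩; exact h
      · intro h; exact h p it.a ⟨rfl, rfl⟩
    · -- `1`-side query: `a = 0`
      rw [hq] at hstep
      have ha : it.a = false := by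
        cases h : it.a
        · rfl
        · rw [h] at hstep
          cases hc : it.c <;> rw [hc] at hstep <;> simp [oStep] at hstep
      simp [oGuess, ha]

/-- The local spec at an aligned offset of a gate. [folklore] -/
theorem locVal_mul (w₀ : QReg N) (F₀ F₁ tab : List Bool) {ι : ℕ} (hι : ι < 2 * gts.length) :
    locVal gts w₀ F₀ F₁ tab ((N + 5) * ι) =
      (decide (stepOut (gts[ι / 2]'(by omega)).1 (gts[ι / 2]'(by omega)).2 (decItem (N := N) (blk (N + 5) tab ι)).c
          (decItem (N := N) (blk (N + 5) tab ι)).a (stAt ((w₀, 0) : PState N) tab (ι % 2) (ι / 2)).1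
          (stAt ((w₀, 0) : PState N) tab (ι % 2) (ι / 2)).2 = some (decItem (N := N) (blk (N + 5) tab ι)).st) &&
        (if ι / 2 + 1 < gts.length then true else decide ((blk (N + 5) tab ι).drop 2 = if ι % 2 = 1 then F₁ else F₀))) := by
  rw [locVal, if_pos (Nat.mul_mod_right _ _), Nat.mul_div_cancel_left _ (by omega : 0 < N + 5),
    List.getElem?_eq_getElem (by omega)]

/-- The guess datum at an aligned offset of a gate. [folklore] -/
theorem guessAt_mul (w₀ : QReg N) (tab : List Bool) {ι : ℕ} (hι : ι < 2 * gts.length) :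
    guessAt gts w₀ tab ((N + 5) * ι) =
      gdat (gts[ι / 2]'(by omega)).1 (stAt ((w₀, 0) : PState N) tab (ι % 2) (ι / 2)) (decItem (N := N) (blk (N + 5) tab ι)) := by
  rw [guessAt, if_pos (Nat.mul_mod_right _ _), Nat.mul_div_cancel_left _ (by omega : 0 < N + 5),
    List.getElem?_eq_getElem (by omega)]
  rcases hg : gts[ι / 2] with ⟨⟨op, e⟩ | ⟨k, e⟩, tbl⟩ <;> rfl

/-- A full item claims the copied state iff its state is the decoded copy. [folklore] -/
theorem drop_two_eq_iff (v F : List Bool) (hv : v.length = N + 5) (hF : F.length = N + 3) :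
    v.drop 2 = F ↔ (decItem (N := N) v).st = decLP (N := N) F := by
  rw [drop_two_item v hv]
  constructor
  · intro h
    rw [← decLP_encLP (t := (decItem (N := N) v).st) (decItem_ph_lt v), h]
  · intro h
    rw [h, encLP_decLP F hF]

/-- A copied state is the initial state `w₀ 000` iff it decodes to `(w₀, 0)`. [folklore] -/
theorem eq_init_iff (w₀ : QReg N) (F : List Bool) (hF : F.length = N + 3) :
    F = List.ofFn w₀ ++ [false, false, false] ↔ decLP (N := N) F = ((w₀, 0) : PState N) := by
  have he : List.ofFn w₀ ++ [false, false, false] = encLP ((w₀, 0) : PState N) := by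
    simp [encLP, bits3]
  rw [he]
  constructor
  · intro h; rw [h, decLP_encLP (by norm_num)]
  · intro h; rw [← h, encLP_decLP F hF]

/-- **Membership in the admissibility language, decoded**: a well-formed `⟨u, Y⟩` is admissible
iff the tableau block of `Y` is admissible from the initial states and the two copied final states
are the final states of the two walks. [cite: AaronsonChen2017, §5.3 (pp. 22–23)] -/
theorem mkZ_mem_Adm_iff (hN : N ≤ pad.length) (hG : gts.length ≤ pad.length)
    (hY : hdr pad.length N + 2 * iw N * gts.length ≤ Y.length) :
    mkZ pad gts w₀ P₁ P₂ σ₁ n₁ σ₂ n₂ Y ∈ Adm B ↔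
      tabAdm B gts ((w₀, 0) : PState N) ((w₀, 0) : PState N) (Y.drop (hdr pad.length N)) = true ∧
      tabFin gts ((w₀, 0) : PState N) ((w₀, 0) : PState N) (Y.drop (hdr pad.length N)) =
        (decLP (N := N) (finOf pad.length N Y false), decLP (N := N) (finOf pad.length N Y true)) := by
  set tab := Y.drop (hdr pad.length N) with htabdef
  set F₀ := finOf pad.length N Y false with hF₀
  set F₁ := finOf pad.length N Y true with hF₁
  have hw : iw N = N + 5 := rfl
  have hF₀l : F₀.length = N + 3 := by rw [hF₀, finOf, if_neg Bool.false_ne_true, List.length_take, List.length_drop, hdr] at *; omega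
  have hF₁l : F₁.length = N + 3 := by rw [hF₁, finOf, if_pos rfl, List.length_take, List.length_drop, hdr] at *; omega
  have htabl : ∀ {ι : ℕ}, ι < 2 * gts.length → (blk (N + 5) tab ι).length = N + 5 := fun {ι} hι => by
    apply length_blk
    rw [htabdef, List.length_drop]
    have h2 : (N + 5) * (ι + 1) ≤ (N + 5) * (2 * gts.length) := Nat.mul_le_mul_left _ (by omega)
    rw [show (N + 5) * (2 * gts.length) = 2 * iw N * gts.length by rw [hw]; ring] at h2
    omega
  obtain ⟨hadm, hfin⟩ := tabAdm_iff_forall B gts ((w₀, 0) : PState N) ((w₀, 0) : PState N) tab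
  -- unfold the three languages
  have hmem : mkZ pad gts w₀ P₁ P₂ σ₁ n₁ σ₂ n₂ Y ∈ Adm B ↔
      (mkZ pad gts w₀ P₁ P₂ σ₁ n₁ σ₂ n₂ Y ∈ AdmL ∧ mkZ pad gts w₀ P₁ P₂ σ₁ n₁ σ₂ n₂ Y ∈ AdmG B) ∧
        mkZ pad gts w₀ P₁ P₂ σ₁ n₁ σ₂ n₂ Y ∈ InitS := Iff.rfl
  rw [hmem, mkZ_mem_AdmL_iff pad gts w₀ P₁ P₂ σ₁ n₁ σ₂ n₂ Y hN hG hY, mkZ_mem_AdmG_iff B pad gts w₀ P₁ P₂ σ₁ n₁ σ₂ n₂ Y hN hG hY,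
    InitS, mem_testLang, initT_mkZ, ← hF₀, ← hF₁, ← htabdef]
  simp only [List.cons.injEq, and_true, decide_eq_true_iff]
  rw [forall_lt_two_mul, forall_lt_two_mul, hadm, hfin, eq_init_iff w₀ F₀ hF₀l, eq_init_iff w₀ F₁ hF₁l]
  -- per gate: local spec ∧ guess condition ↔ itemOK ∧ last-gate claims
  have hgate : ∀ (i : ℕ) (hi : i < gts.length),
      ((locVal gts w₀ F₀ F₁ tab ((N + 5) * (2 * i)) = true ∧ locVal gts w₀ F₀ F₁ tab ((N + 5) * (2 * i + 1)) = true) ∧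
        ((∀ (p : List Bool) (b : Bool), guessAt gts w₀ tab ((N + 5) * (2 * i)) = some (p, b) → (b = true ↔ p ∈ B)) ∧
         (∀ (p : List Bool) (b : Bool), guessAt gts w₀ tab ((N + 5) * (2 * i + 1)) = some (p, b) → (b = true ↔ p ∈ B)))) ↔
      ((itemOK B (gts[i]).1 (gts[i]).2 (stAt ((w₀, 0) : PState N) tab 0 i) (decItem (N := N) (blk (iw N) tab (2 * i))) ∧
        itemOK B (gts[i]).1 (gts[i]).2 (stAt ((w₀, 0) : PState N) tab 1 i) (decItem (N := N) (blk (iw N) tab (2 * i + 1)))) ∧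
       (i + 1 = gts.length →
        (decItem (N := N) (blk (N + 5) tab (2 * i))).st = decLP (N := N) F₀ ∧
        (decItem (N := N) (blk (N + 5) tab (2 * i + 1))).st = decLP (N := N) F₁)) := by
    intro i hi
    have h0 : 2 * i < 2 * gts.length := by omega
    have h1 : 2 * i + 1 < 2 * gts.length := by omega
    rw [locVal_mul gts w₀ F₀ F₁ tab h0, locVal_mul gts w₀ F₀ F₁ tab h1, guessAt_mul gts w₀ tab h0, guessAt_mul gts w₀ tab h1,
      itemOK_iff, itemOK_iff]
    have e0 : 2 * i / 2 = i := by omega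
    have e1 : (2 * i + 1) / 2 = i := by omega
    have m0 : 2 * i % 2 = 0 := by omega
    have m1 : (2 * i + 1) % 2 = 1 := by omega
    simp only [e0, e1, m0, m1, Bool.and_eq_true, decide_eq_true_iff, hw, Nat.zero_ne_one, if_false, if_true,
      drop_two_eq_iff _ _ (htabl h0) hF₀l, drop_two_eq_iff _ _ (htabl h1) hF₁l]
    by_cases hlast : i + 1 < gts.length
    · simp only [hlast, if_true, and_true, show ¬ (i + 1 = gts.length) from by omega, false_implies]
      constructor
      · rintro ⟨⟨a0, a1⟩, g0, g1⟩; exact ⟨⟨a0, g0⟩, a1, g1⟩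
      · rintro ⟨⟨a0, g0⟩, a1, g1⟩; exact ⟨⟨a0, a1⟩, g0, g1⟩
    · have heq : i + 1 = gts.length := by omega
      simp only [heq, lt_self_iff_false, if_false, decide_eq_true_iff, true_implies]
      constructor
      · rintro ⟨⟨⟨a0, c0⟩, a1, c1⟩, g0, g1⟩; exact ⟨⟨⟨a0, g0⟩, a1, g1⟩, c0, c1⟩
      · rintro ⟨⟨⟨a0, g0⟩, a1, g1⟩, c0, c1⟩; exact ⟨⟨⟨a0, c0⟩, a1, c1⟩, g0, g1⟩
  constructor
  · rintro ⟨⟨hloc, hgu⟩, hinit⟩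
    have hall := fun i (hi : i < gts.length) => (hgate i hi).1 ⟨hloc i hi, hgu i hi⟩
    refine ⟨fun i hi => (hall i hi).1, ?_⟩
    cases hGz : gts.length with
    | zero =>
      obtain ⟨h0, h1⟩ := hinit (List.length_eq_zero_iff.1 hGz)
      simp only [stAt, h0, h1]
    | succ G' =>
      obtain ⟨h0, h1⟩ := (hall G' (by omega)).2 (by omega)
      simp only [stAt, hw, h0, h1, Nat.add_zero]
  · rintro ⟨hok, hfinal⟩
    have hlast' : ∀ i < gts.length, i + 1 = gts.length →
        (decItem (N := N) (blk (N + 5) tab (2 * i))).st = decLP (N := N) F₀ ∧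
        (decItem (N := N) (blk (N + 5) tab (2 * i + 1))).st = decLP (N := N) F₁ := by
      intro i hi heq
      rw [← heq] at hfinal
      simp only [stAt, hw, Nat.add_zero, Prod.mk.injEq] at hfinal
      exact hfinal
    refine ⟨⟨fun i hi => ((hgate i hi).2 ⟨hok i hi, hlast' i hi⟩).1, fun i hi => ((hgate i hi).2 ⟨hok i hi, hlast' i hi⟩).2⟩, ?_⟩
    intro hnil
    subst hnil
    simpa [stAt, Prod.mk.injEq, eq_comm] using hfinal

end Membership



end AcTab

end Literature.Barriers.QuantumAdvantage

end
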